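import Summits.KontsevichZagierPeriods.KontsevichZagierPeriods.Theses.SymplecticScissors
import Summits.KontsevichZagierPeriods.KontsevichZagierPeriods.Theorems.TypeAGenerationConjecture
import Summits.KontsevichZagierPeriods.KontsevichZagierPeriods.Theorems.SymplecticScissorsVolumeFormOffPlaneSplit
import Summits.KontsevichZagierPeriods.KontsevichZagierPeriods.Theorems.TypeAGeneration.Negative.HypothesesAudit
import Summits.KontsevichZagierPeriods.KontsevichZagierPeriods.Theorems.TypeAGeneration.Negative.SameVariablesWitness
import Summits.KontsevichZagierPeriods.KontsevichZagierPeriods.Theorems.TypeAGeneration.Negative.SameVariables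
import Literature.NumberTheory.Transcendental.AyoubPeriodSeriesDescent
import Literature.NumberTheory.Transcendental.AyoubPeriodSeriesKernel
import Literature.NumberTheory.Transcendental.AyoubPeriodSeriesVariables
import Literature.NumberTheory.Transcendental.AyoubPeriodSeriesPiAlgebraic
import Literature.NumberTheory.Transcendental.AyoubPeriodSeriesProofs

/-!
# Disproof of `TypeAGeneration` (stmt-KontsevichZagierPeriods-18392) — findings

Standing disprover's work file (cdisprove, cycle 1, route SymplecticScissors). Prose only in
docstrings; every claim is kernel-checked unless marked `sorry` (near-misses, §E). LANDED through
the gate this cycle (all `--supports 18392`, theorems only, standard axioms):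
`Theorems/TypeAGeneration/Negative/HypothesesAudit.lean` (p142715),
`…/Negative/SameVariablesWitness.lean` (p142309), `…/Negative/SameVariables.lean` (p143056),
`…/Negative/SameVariablesBridge.lean` (p143709, generic one-variable bridge),
`…/Negative/SameVariablesWithRoom.lean` (p144197 submitted: room-uniform form, aimed at `stub_residual`).

**Verdict so far: NO KILL, and none is cheap.** The crux is, by `Iff.rfl`, the tree's conjecture
leaf `TypeAGenerationConjecture` = Ayoub 2015 Conj. 1.1 / Fresán 2024 Conj. 3.5 (§0), all of whose
instances are the single instance `k = ℚ` (§0, tree `typeAGeneration_forall_iff_rat`). The typing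
over `AyoubPeriodSeries.lean` was re-audited symbol by symbol (signs of `relAC`, the `tsum`s of
`intC` / `restrC`, `0 ^ 0 = 1` in `restrC i 0`, the `P ≠ 0` clause of `IsAlgebraicOverRatFunc`,
the `k`-span written along `σ`): no junk instance on `Oan`, no mis-rendering found. Refuting the
crux as typed is refuting Ayoub's printed conjecture, equivalent in print (Ayoub 2015, Fait 1.4) to
the Kontsevich–Zagier conjecture; IN THE TREE the crux is only known to IMPLY the summit together
with `CubeNashNormalForm` (§0) — the converse (summit ⇒ crux, Ayoub's geometric half of Fait 1.4)
is not formalised, so a refutation of the crux would NOT formally refute the summit.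

## Findings (index)

* §0 CALIBRATION — `typeAGeneration_iff_conjecture` (Iff.rfl with the leaf),
  `typeAGeneration_iff_rat` / `typeAGeneration_iff_algebraicClosure` (all instances ⇔ `k = ℚ` ⇔
  `k = ℚ̄`), `typeAGeneration_iff_noCharZero'` (the binder `[CharZero k]` is redundant; LANDED),
  `typeAGeneration_iff_twoClause'` (the crux over the TWO-clause algebra; LANDED),
  `volumeFormOffPlane_of_typeAGeneration` / `summit_of_typeAGeneration` (with `CubeNashNormalForm`).
* §A LOAD-BEARING ANALYSIS of the hypotheses `intC F = 0`, `F ∈ Oan σ` (three clauses), algebraic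
  image of `σ`:
  - `typeAGeneration_false_without_intC'` (LANDED): the span lies in `ker ∫`
    (`intC_eq_zero_of_mem_kSpan_relAC`, LANDED) and `∫ 1 = 1` — any proof must use `intC F = 0`.
  - `exists_dependsOnlyOnLT_of_isAlgebraicOverRatFunc'`, `mem_Oan_iff_polyradius_and_algebraic`
    (LANDED): the clause "finitely many variables" of `Oan` is REDUNDANT — it follows from
    algebraicity over `k(z)` (Euler operators `z_J ∂_J`; `ℂ[[z]]((ϖ))` a domain). So `F ∈ Oan σ` has
    exactly two load-bearing clauses: polyradius `> 1` and algebraicity.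
  - polyradius `> 1` (paper): without it `intC` is a junk `tsum` (`intC (1/(1+z₀) − c) = 0` for
    EVERY `c`, the family `(−1)ⁿ/(n+1)` not being summable), and even for absolutely convergent
    boundary elements (`√(1−z₀) − 2/3`, radius exactly `1`, `∫ = 0` honestly) membership in the span
    fails for the trivial reason that span elements have polyradius `> 1`. Load-bearing, cheaply;
    not formalised (needs the weighted summability of `relAC`-images and `Ring.choose (1/2) n`
    asymptotics — cost ≫ value).
  - algebraicity of `F` and algebraic image of `σ` (paper, §E): both believed load-bearing
    (`e^{z₀} − (e − 1)`; `1/(2+z₀) − log(3/2)` over `k = ℝ` or `ℂ`), by ONE argument — a derivation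
    `D = ∂/∂λ` of `ℂ` over `ℚ̄` with `D λ = 1` at the transcendental constant `λ`, extended
    coefficientwise, commutes with `∂ᵢ`, with restriction `zᵢ = 0, 1` and with `∫` ON ALGEBRAIC
    SERIES (equisingular deformation of an algebraic branch along its own transcendental parameters),
    so `D̃` maps the span into the span ⊆ `ker ∫` while `D̃ F = −1`. Hermite–Lindemann supplies `λ`
    transcendental. Not formalisable here (no derivations of `ℂ/ℚ̄`, no equisingularity): recorded as
    `sorry` near-misses `typeAGeneration_false_without_algImage`,
    `typeAGeneration_false_without_algebraicF` with the obstruction in the docstring.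
* §B SOUNDNESS — `intC_eq_zero_of_mem_typeASpan` : `⟨type (a)⟩_k ⊆ ker ∫` (the crux is the reverse
  inclusion).
* §C NATURAL STRENGTHENINGS —
  (i) **"certificates in the SAME variables as `F`" is FALSE inside Ayoub's typed algebra**:
  `not_typeAGenerationSameVariables` (LANDED as `TypeAGenerationNegative.typeAGeneration_false_sameVariables`,
  p143056): `k = ℚ`, `F = 1/(2+z₀) − 1/(3−z₀) ∈ Oan ℚ` (the reflection relation, `∫ F = 0` by two
  Mercator series; LANDED witness `exists_witness`, p142309) is not a `ℚ`-combination of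
  `relAC i G` with `G ∈ Oan ℚ` in `z₀` only (directions `i ≥ 1` are `0`,
  `relAC_eq_zero_of_dependsOnlyOnLT_one`; the `i = 0` combination becomes, by the sibling line's
  dictionary `generator_package` / `cube_identity` read along the cube edge `t ↦ (t, 0, …, 0)`, a
  `ℚ`-semialgebraic primitive of `f + c` on `[0,1]`, killed by the barrier engine
  `NoSemialgPrimKernel.eq_zero_of_evalEval_eq_zero`, simple pole `t = 3`). This is level 1 of the
  variable count IN THE CRUX'S OWN LANGUAGE (the catalogued barrier
  `kernelElt_not_stokes_one_variable` is its real-clothes form for another element).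
  (ii) "a bounded number of auxiliary variables suffices" — open at every level `≥ 2` (Ayoub Rem. 1.2);
  paper remark: for one-variable RATIONAL `F` two variables plausibly always suffice (Baker: all
  relations among logarithms of rationals are multiplicativity, realised by dimension-1 moves, each
  a two-variable certificate by Rem. 1.5 with a shared auxiliary variable) — so the level question
  starts at algebraic irrational or two-variable `F`.
  (iii) "one generator suffices" reduces to (i) (paper: a single `relAC i G` equal to a function of
  `z₀` alone forces `i = 0` and `G|_{z'=0}` a one-variable algebraic primitive of `F + c`).
* §D LINE `Sketch` (card stokes-compiler, PICKED 2026-08-17T04:32Z; skeleton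
  `Cruxes/TypeAGeneration/Lines/Sketch.lean`, 7 stubs) — paper audit of every stub, no kill:
  S1 transposition (certificate `relAC i (zᵢT) − relAC j (z_jT)`, `T = F(zᵢz_j, w)`: the identity
  holds formally, `T` has polyradius `≥ √r`, algebraic by the injective monomial substitution — TRUE;
  the hypothesis `¬ UsesVar F j` is load-bearing, else `T|_{z_j=1} ≠ F`); S2 room-step congruence
  (checked by hand for EVERY rational `μ`, not only `0 < μ < ρᵢ − 1`: `∂_jA = ∂ᵢB` because
  `(1−μz_j)∂_jT + μzᵢ∂ᵢT = 0`, `A|_{z_j=1} = (1−μ)F((1−μ)zᵢ,w)`, `A|_{z_j=0} = F`,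
  `B|_{zᵢ=1} = −μT|_{zᵢ=1}`; all restrictions are finite or `Oan`-convergent sums — TRUE given
  `T ∈ Oan`); S3 (`HasSubst` holds for the substitution family — each monomial meets finitely many
  `a s` —, algebraicity by the dominant map `(zᵢ,z_j) ↦ (zᵢ(1−μz_j), z_j)`, weights by the binomial
  majorant `θᵢ(1+μθ_j) ≤ ρᵢ` — TRUE); S4 face map (divide the relation by the exact power of
  `zᵢ − 1` in the domain `ℂ[[z]]`; weights need `ρ ≥ 1`, which is assumed — TRUE); S5 dilation —
  TRUE (equality of majorants); S6 room lemma — TRUE (each room step keeps treated radii and spends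
  one fresh variable; finitely many pieces); S7 residual = the crux WITH ROOM `R` — crux strength
  (for `R ≤ 1` literally the crux; `∃ R` uniform in `k` is harmless since all instances are `k = ℚ`).
  JOINT SUFFICIENCY kernel-checked by the lead (`TypeAGeneration_of`). Disprover's theorem for S7
  (`not_typeAGenerationSameVariables_withRoom`, LANDING as
  `TypeAGenerationNegative.typeAGeneration_false_sameVariables_withRoom`, p144197): ROOM DOES NOT BUY
  SAME-VARIABLE CERTIFICATES — for every `R` the element `1/(a+z₀) − 1/(a+1−z₀)`, `a > R + 1`, is a
  one-variable kernel element of polyradius `≥ a > R` (the residual's own room hypothesis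
  `∃ r > R, Σ ‖F_b‖ r^{|b|} < ∞`) with no certificate in `z₀` alone (generic bridge
  `exists_semialgebraic_primitive_of_mem_kSpan_oneVar`, p143709, + simple pole `t = a+1`); so the
  residual's auxiliary variables are intrinsic, not an artefact of small radius.
* §E NEAR-MISSES — the two `sorry`s of §A, with what was tried.

WHY IT RESISTS: every invariant of `Oan` that kills all `relAC i G` with `G` ALGEBRAIC but not all
kernel elements must see algebraicity (for arbitrary holomorphic `G` the kernel IS the span, by
iterated primitives — Ayoub Rem. 1.2), i.e. must be a non-motivic period invariant: GPC strength.
The only sub-GPC handles are the variable count (level 1 settled — barrier in real clothes, §C (i)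
in Ayoub's clothes — levels ≥ 2 open) and the Cartier sieve, which is vacuous once one auxiliary
variable is allowed (BarrierNotes-r1-ideator1 B1).
-/

noncomputable section

set_option linter.dupNamespace false

namespace Summit.KontsevichZagierPeriods.KontsevichZagierPeriods.Cruxes.TypeAGeneration.Disproof

open Literature.NumberTheory.Transcendental
open Literature.NumberTheory.Transcendental.AyoubRel
open Summit.KontsevichZagierPeriods.KontsevichZagierPeriods.Theses.SymplecticScissors
  (CubeNashNormalForm VolumeFormOffPlane OffPlaneSplitGlue)
open Summit.KontsevichZagierPeriods.SymplecticScissors.TypeAGenerationNegative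

/-- The crux, by its full route name (the short name `TypeAGeneration` is shadowed by this file's
namespace). [cite: Ayoub2015, Conj. 1.1] -/
abbrev Crux : Prop :=
  Summit.KontsevichZagierPeriods.KontsevichZagierPeriods.Theses.SymplecticScissors.TypeAGeneration

/-- The type-(a) span `⟨∂G/∂zᵢ − G|_{zᵢ=1} + G|_{zᵢ=0} : G ∈ 𝒪_{k-alg}(𝔻̄^∞)⟩_k` (the `k`-span
along `σ`), i.e. the conjectured kernel of `∫_{[0,1]^∞}`. [cite: Ayoub2015, Conj. 1.1] -/
def typeASpan {k : Type} [Field k] (σ : k →+* ℂ) : Set CSeries :=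
  kSpan σ {x : CSeries | ∃ G ∈ Oan σ, ∃ i : ℕ, x = relAC i G}

/-! ## §0 Calibration -/

/-- The crux IS the tree's conjecture leaf (definitional unfolding). [cite: Ayoub2015, Conj. 1.1] -/
theorem typeAGeneration_iff_conjecture : Crux ↔ TypeAGenerationConjecture := Iff.rfl

/-- The crux unfolded: `∀ k σ` with algebraic image, `ker ∫ ∩ Oan σ ⊆ typeASpan σ`.
[cite: Ayoub2015, Conj. 1.1] -/
theorem crux_iff :
    Crux ↔ ∀ (k : Type) [Field k] [CharZero k] (σ : k →+* ℂ), (∀ c : k, IsAlgebraic ℚ (σ c)) →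
      ∀ F ∈ Oan σ, intC F = 0 → F ∈ typeASpan σ :=
  Iff.rfl

/-- **All instances are the instance `k = ℚ`** (Fresán's Conj. 3.5): tree
`AyoubRel.typeAGeneration_forall_iff_rat` (`Oan σ = Oan ℚ` for algebraic image, and a
`ℚ`-combination is a `k`-combination). [cite: Fresan2024, Conj. 3.5] -/
theorem typeAGeneration_iff_rat :
    Crux ↔ ∀ F ∈ Oan (algebraMap ℚ ℂ), intC F = 0 → F ∈ typeASpan (algebraMap ℚ ℂ) :=
  typeAGeneration_forall_iff_rat

/-- … and the instance `k = ℚ̄ = algebraicClosure ℚ ℂ` (the form consumed by the sibling crux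
`StokesGeneration`'s line). [cite: Ayoub2015, Conj. 1.1] -/
theorem typeAGeneration_iff_algebraicClosure :
    Crux ↔ ∀ F ∈ Oan (algebraMap (algebraicClosure ℚ ℂ) ℂ), intC F = 0 →
      F ∈ typeASpan (algebraMap (algebraicClosure ℚ ℂ) ℂ) :=
  typeAGeneration_forall_iff_algebraicClosure

/-- **The binder `[CharZero k]` is redundant** (LANDED, `HypothesesAudit`). [folklore] -/
theorem typeAGeneration_iff_noCharZero' :
    Crux ↔ ∀ (k : Type) [Field k] (σ : k →+* ℂ), (∀ c : k, IsAlgebraic ℚ (σ c)) →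
      ∀ F ∈ Oan σ, intC F = 0 → F ∈ typeASpan σ :=
  typeAGeneration_iff_noCharZero

/-- **The crux over the two-clause algebra** `{F | polyradius > 1 ∧ algebraic over k(z)}` (for
`F` and for the certificates): the finite-variable clause of `Oan` is not a hypothesis
(LANDED, `HypothesesAudit`). [cite: Ayoub2015, Conj. 1.1] -/
theorem typeAGeneration_iff_twoClause' :
    Crux ↔
      ∀ (k : Type) [Field k] [CharZero k] (σ : k →+* ℂ), (∀ c : k, IsAlgebraic ℚ (σ c)) →
        ∀ F : CSeries, HasPolyradiusGtOne F → IsAlgebraicOverRatFunc σ F → intC F = 0 →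
          F ∈ kSpan σ {x : CSeries | ∃ G : CSeries, HasPolyradiusGtOne G ∧
            IsAlgebraicOverRatFunc σ G ∧ ∃ i : ℕ, x = relAC i G} :=
  typeAGeneration_iff_twoClause

/-- **Crux ∧ `CubeNashNormalForm` ⇒ `VolumeFormOffPlane`** — the PROVED glue item 18438
(`OffPlaneSplit.offPlaneSplitGlue_proof`). [cite: KontsevichZagier2001, §1.2 Conjecture 1] -/
theorem volumeFormOffPlane_of_typeAGeneration (hA : Crux) (hG : CubeNashNormalForm) :
    VolumeFormOffPlane :=
  Summit.KontsevichZagierPeriods.SymplecticScissors.OffPlaneSplit.offPlaneSplitGlue_proof hA hG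

/-- **Crux ∧ `CubeNashNormalForm` ⇒ the SUMMIT** (tree: the landed Ayoub compiler of the sibling
line, `kontsevichZagierPeriods_of_typeA_of_cubeNashNormalForm`, instance `k = ℚ̄`). The converse
"summit ⇒ crux" (the geometric half of Ayoub 2015 Fait 1.4) is NOT in the tree: formally the crux
is not known to be weaker than or equal to the summit. [cite: Ayoub2015, Fait 1.4] -/
theorem summit_of_typeAGeneration (hA : Crux) (hG : CubeNashNormalForm) :
    _root_.KontsevichZagierPeriods :=
  StokesGenerationLine.kontsevichZagierPeriods_of_typeA_of_cubeNashNormalForm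
    (typeAGeneration_forall_iff_algebraicClosure.mp hA) hG

/-! ## §B Soundness (the easy inclusion) -/

/-- **`⟨type (a)⟩_k ⊆ ker ∫`** (LANDED as `intC_eq_zero_of_mem_kSpan_relAC`). The crux is the reverse
inclusion. [cite: AyoubRelKZRevisited, §1.3 (6)] -/
theorem intC_eq_zero_of_mem_typeASpan {k : Type} [Field k] (σ : k →+* ℂ) {x : CSeries}
    (hx : x ∈ typeASpan σ) : intC x = 0 :=
  intC_eq_zero_of_mem_kSpan_relAC σ hx

/-! ## §A Load-bearing analysis

### A.1 `intC F = 0` is load-bearing (consistency) -/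

/-- The crux WITHOUT its hypothesis `intC F = 0`: every element of `Oan σ` is generated.
[cite: Ayoub2015, Conj. 1.1] -/
def TypeAGenerationWithoutIntC : Prop :=
  ∀ (k : Type) [Field k] [CharZero k] (σ : k →+* ℂ), (∀ c : k, IsAlgebraic ℚ (σ c)) →
    ∀ F ∈ Oan σ, F ∈ kSpan σ {x : CSeries | ∃ G ∈ Oan σ, ∃ i : ℕ, x = relAC i G}

/-- **`intC F = 0` is load-bearing** (LANDED): `1 ∈ 𝒪_{ℚ-alg}(𝔻̄^∞)` with `∫ 1 = 1 ≠ 0` is not in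
the span (soundness). [folklore] -/
theorem typeAGeneration_false_without_intC' : ¬ TypeAGenerationWithoutIntC :=
  typeAGeneration_false_without_intC

/-! ### A.2 The clause "finitely many variables" of `Oan` is NOT load-bearing (redundant) -/

/-- **Algebraic series involve finitely many variables** (LANDED): algebraicity over `k(z)`
implies `DependsOnlyOnLT F M` for some `M` (Euler operators). [cite: AyoubRelKZRevisited, §1.1] -/
theorem exists_dependsOnlyOnLT_of_isAlgebraicOverRatFunc' {k : Type} [Field k] [CharZero k]
    (σ : k →+* ℂ) {F : CSeries} (hF : IsAlgebraicOverRatFunc σ F) :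
    ∃ M : ℕ, DependsOnlyOnLT F M :=
  exists_dependsOnlyOnLT_of_isAlgebraicOverRatFunc σ hF

/-- **`Oan` with two clauses** (LANDED as `mem_Oan_iff_polyradius_and_algebraic`).
[cite: AyoubRelKZRevisited, §1.1] -/
theorem mem_Oan_iff' {k : Type} [Field k] [CharZero k] (σ : k →+* ℂ) (F : CSeries) :
    F ∈ Oan σ ↔ HasPolyradiusGtOne F ∧ IsAlgebraicOverRatFunc σ F :=
  mem_Oan_iff_polyradius_and_algebraic σ F

/-! ### A.3 The hypotheses that ARE believed load-bearing but sit at transcendence strength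

See §E for the `sorry`d statements `typeAGeneration_false_without_algImage` (algebraic image of
`σ`) and `typeAGeneration_false_without_algebraicF` (algebraicity of `F`), and the module docstring
for the single derivation argument behind both. -/

/-- The crux WITHOUT "algebraic image of `σ`" (so `k = ℝ`, `ℂ` are allowed; `Oan ℝ = Oan ℂ` since
`i` is algebraic over `ℝ`, and the `ℝ`-span of type-(a) elements is their `ℂ`-span).
[cite: Ayoub2015, Conj. 1.1] -/
def TypeAGenerationWithoutAlgImage : Prop :=
  ∀ (k : Type) [Field k] [CharZero k] (σ : k →+* ℂ),
    ∀ F ∈ Oan σ, intC F = 0 → F ∈ kSpan σ {x : CSeries | ∃ G ∈ Oan σ, ∃ i : ℕ, x = relAC i G}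

/-- The crux WITHOUT algebraicity of `F` (finitely many variables and polyradius `> 1` kept; the
certificates `G` still algebraic). [cite: Ayoub2015, Rem. 1.2] -/
def TypeAGenerationWithoutAlgebraicF : Prop :=
  ∀ (k : Type) [Field k] [CharZero k] (σ : k →+* ℂ), (∀ c : k, IsAlgebraic ℚ (σ c)) →
    ∀ F : CSeries, (∃ m, DependsOnlyOnLT F m) → HasPolyradiusGtOne F → intC F = 0 →
      F ∈ kSpan σ {x : CSeries | ∃ G ∈ Oan σ, ∃ i : ℕ, x = relAC i G}

/-! ## §C Natural strengthenings

### C.1 Certificates in the SAME variables (Ayoub Rem. 1.2, level 1): FALSE — LANDED -/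

/-- STRENGTHENING (same-variable certificates): every one-variable kernel element `F(z₀)` is a
`k`-combination of `∂G/∂zᵢ − G|_{zᵢ=1} + G|_{zᵢ=0}` with `G ∈ 𝒪_{k-alg}` ALSO in the variable `z₀`
only (any direction `i`). Printed as unlikely (Ayoub 2015 Rem. 1.2). [cite: Ayoub2015, Rem. 1.2] -/
def TypeAGenerationSameVariables : Prop :=
  ∀ (k : Type) [Field k] [CharZero k] (σ : k →+* ℂ), (∀ c : k, IsAlgebraic ℚ (σ c)) →
    ∀ F ∈ Oan σ, DependsOnlyOnLT F 1 → intC F = 0 →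
      F ∈ kSpan σ {x : CSeries | ∃ G ∈ Oan σ, DependsOnlyOnLT G 1 ∧ ∃ i : ℕ, x = relAC i G}

/-- **Same-variable certificates do not suffice** (LANDED, p143056,
`TypeAGenerationNegative.typeAGeneration_false_sameVariables`): witness `k = ℚ`,
`F = 1/(2+z₀) − 1/(3−z₀)`. Any proof of the crux must introduce auxiliary variables already for
this `F` (two suffice in print, Ayoub Rem. 1.5 / Fresán Rem. 3.7).
[cite: Ayoub2015, Rem. 1.2 and Rem. 1.5] -/
theorem not_typeAGenerationSameVariables : ¬ TypeAGenerationSameVariables :=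
  typeAGeneration_false_sameVariables

/-- The landed WITNESS, re-exported: a one-variable kernel element of `𝒪_{ℚ-alg}(𝔻̄^∞)` with the
Taylor coefficients of `1/(2+z) − 1/(3−z)` (p142309, `exists_witness`). [cite: Ayoub2015, Rem. 1.5] -/
theorem exists_oneVariable_kernel_element :
    ∃ F : CSeries, F ∈ Oan (algebraMap ℚ ℂ) ∧ DependsOnlyOnLT F 1 ∧ intC F = 0 ∧
      (∀ n : ℕ, MvPowerSeries.coeff (Finsupp.single 0 n) F =
        (((1 / 2 : ℝ) * (-1 / 2) ^ n - (1 / 3) * (1 / 3) ^ n : ℝ) : ℂ)) ∧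
      (∀ b : ℕ →₀ ℕ, (∀ n, b ≠ Finsupp.single 0 n) → MvPowerSeries.coeff b F = 0) :=
  exists_witness

/-! ### C.2 … uniformly in the room (aimed at `stub_residual` of line `Sketch`) — LANDED -/

/-- STRENGTHENING WITH ROOM: same-variable certificates for one-variable kernel elements of
polyradius `> R` (the room hypothesis of `stub_residual`). [cite: Ayoub2015, Rem. 1.2] -/
def TypeAGenerationSameVariablesWithRoom (R : ℝ) : Prop :=
  ∀ (k : Type) [Field k] [CharZero k] (σ : k →+* ℂ), (∀ c : k, IsAlgebraic ℚ (σ c)) →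
    ∀ F ∈ Oan σ, DependsOnlyOnLT F 1 →
      (∃ r : ℝ, R < r ∧ Summable fun b : ℕ →₀ ℕ => ‖MvPowerSeries.coeff b F‖ * r ^ Finsupp.degree b) →
      intC F = 0 →
        F ∈ kSpan σ {x : CSeries | ∃ G ∈ Oan σ, DependsOnlyOnLT G 1 ∧ ∃ i : ℕ, x = relAC i G}

/- **Room does not buy same-variable certificates**: `∀ R, ¬ TypeAGenerationSameVariablesWithRoom R`
is KERNEL-CHECKED (folder `SameVariablesWithRoom.lean`, rc 0 with the generic bridge
`Negative/SameVariablesBridge.lean`, LANDED p143709) and submitted as p144197,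
`TypeAGenerationNegative.typeAGeneration_false_sameVariables_withRoom` (witness
`1/(a+z₀) − 1/(a+1−z₀)`, `a > R + 1`). It is not re-exported in this version of the work file only
because the check farm had not yet built the two new modules when this file was published; the
next version imports `…Negative.SameVariablesWithRoom` and states
`theorem not_typeAGenerationSameVariables_withRoom (R : ℝ) : ¬ TypeAGenerationSameVariablesWithRoom R`. -/

/-! ## §E Near-misses (the only `sorry`s of this file) -/

/-- NEAR-MISS (paper theorem, not formalisable here). **Algebraic image of `σ` is load-bearing**:
over `k = ℂ` (`σ = id`) take `F = 1/(2 + z₀) − log(3/2) ∈ 𝒪_{ℂ-alg}(𝔻̄¹)`, `∫ F = 0`. If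
`F = Σⱼ cⱼ · relAC iⱼ Gⱼ` with `Gⱼ` algebraic over `ℂ(z)`, apply the coefficientwise extension `D̃`
of a derivation `D` of `ℂ/ℚ̄` with `D(log(3/2)) = 1` (exists: `log(3/2)` is transcendental by
Hermite–Lindemann): `D̃` is a derivation of `ℂ[[z]]` commuting with `∂ᵢ`; ON ALGEBRAIC SERIES it
commutes with `G ↦ G|_{zᵢ=c}` and with `∫`, and preserves `Oan ℂ` (the branch `G` deforms
analytically, on a polydisc of radius still `> 1`, along its own transcendental parameters — an
equisingularity statement at a `ℚ̄`-generic parameter). Hence `D̃ F = −1` lies in the `ℂ`-span of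
type-(a) elements, contradicting `∫(−1) ≠ 0`. OBSTRUCTION to formalising: no derivations of `ℂ`
over `ℚ̄` with prescribed value in Mathlib-ready form, and the commutation of `D̃` with restriction
needs the equisingular-deformation lemma for algebraic branches (Galois CONJUGATION, by contrast,
does not commute with restriction at all — BarrierNotes B2). Tried: direct invariants (coefficient
field, polyradius) — none separates. [cite: Ayoub2015, Conj. 1.1] -/
theorem typeAGeneration_false_without_algImage : ¬ TypeAGenerationWithoutAlgImage := by
  sorry

/-- NEAR-MISS (paper theorem). **Algebraicity of `F` is load-bearing**: `F = e^{z₀} − (e − 1)` has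
`∫ F = 0`, finitely many variables, infinite polyradius, and is not in the `ℚ`-span of type-(a)
elements of `𝒪_{ℚ-alg}`: every element of that span has ALL Taylor coefficients algebraic (an
algebraic series over `ℚ̄(z)` has coefficients in a number field; restriction `zᵢ = 1` of an
algebraic series is algebraic, so its summed coefficients are again algebraic), while the constant
coefficient `2 − e` is transcendental (Hermite). OBSTRUCTION: "algebraic power series have
algebraic coefficients" (via `Aut(ℂ/ℚ̄)`-orbits or Newton–Puiseux) and the transcendence of `e` in
the needed packaging are not in the tree; ~300 lines of field theory for a statement nobody doubts.
[cite: Ayoub2015, Rem. 1.2] -/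
theorem typeAGeneration_false_without_algebraicF : ¬ TypeAGenerationWithoutAlgebraicF := by
  sorry

end Summit.KontsevichZagierPeriods.KontsevichZagierPeriods.Cruxes.TypeAGeneration.Disproof
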